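import Literature.Geometry.Lorentzian.KerrRicciFlat
import HarnessLib

/-!
# `KerrShieldedSettles`, line `tapered-temporal-collar` — stub S2 `stub_kerrVacuum`

The registered stub S2 of the crux `KerrShieldedSettles` (item stmt-FinalStateConjecture-10054): the
Kerr–Schild Kerr metric `Kerr.metric M a r₀ = η + 2Hℓ⊗ℓ` is Ricci-flat on the whole chart domain
`Kerr.region a r₀ = {r > max r₀ 0}`, for ALL real `M, a, r₀` — literally the unfolding of the named fact
`Kerr.isRicciFlat M a r₀`, which the tree now PROVES as `Kerr.isRicciFlat_holds`
(`Literature/Geometry/Lorentzian/KerrRicciFlat.lean`, via Kerr's ingoing coordinates in which the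
components are rational). In the line's composition `KerrShieldedSettles_of` this is what makes the tapered
collar a VACUUM Cauchy development (consumed by S3 `stub_collarEmbedsMGHD`). An independent verification by
kernel-checked polynomial certificates in the Cartesian Kerr–Schild chart is landed alongside as the
`…StubKerrVacuumAux*` modules of this line.

References: Kerr, PRL 11 (1963) 237; Kerr–Schild (1965) §3; O'Neill, *The geometry of Kerr black holes*
(1995), Ch. 2, Thm. 2.6.1.
-/

set_option linter.dupNamespace false

noncomputable section

open Literature.Geometry.Lorentzian

namespace Summit.FinalStateConjecture.FinalStateConjecture.Theorems.SwallowTheDatum.KerrShieldedSettles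

/-- **S2 `stub_kerrVacuum` — Kerr–Schild Kerr is vacuum**: `Ric(g_{M,a}) = 0` at every point of
`Kerr.region a r₀`, for all real `M, a, r₀` (the named fact `Kerr.isRicciFlat`, proved in the tree as
`Kerr.isRicciFlat_holds`). [cite: KerrSchild1965, §3] -/
theorem stub_kerrVacuum : ∀ [Kerr.Facts] (M a r₀ : ℝ) [(Kerr.metric M a r₀).HasLeviCivita]
    (x : Kerr.region a r₀), (Kerr.metric M a r₀).ricci x = 0 :=
  fun M a r₀ _ x ↦ Kerr.isRicciFlat_holds M a r₀ x

end Summit.FinalStateConjecture.FinalStateConjecture.Theorems.SwallowTheDatum.KerrShieldedSettles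

end
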